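import Mathlib
import HarnessLib
import Summits.ResolutionOfSingularities.ResolutionOfSingularities.Theorems.HomologicalConductorNoZenoBirthDefs
import Summits.ResolutionOfSingularities.ResolutionOfSingularities.Theorems.HomologicalConductorNoZenoFibreClosed

/-!
# Crux `NoZenoR` (stmt-ResolutionOfSingularities-19943), slot 5 (B1) upstairs seam (A2):
# «C-curves lie in the chart» for the NORMALISED chart ring `N = nrm k[T ∪ I·x⁻¹]`

OURS (cell res-hironaka, crux chain W4.4, seat res-D-pv-045 gen 8; object (o-A2) of the lead's
B1-CENSUS-g8 §2 (A2)); nothing here is a statement of the manuscript under review (Hironaka 2017);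
AI-written, weaker than expert review.  SUPPORT-level, counted 0.  Def-free, fact-free.

The route-independent work is `…NoZenoFibreClosed` (`closure_subset_preimage_chart`: for `ρ : Z ⟶
Spec T` separated, `U ⊆ Z` open, `σ : U ⟶ Spec N` universally closed over `Spec T`, `N ⊇ T ∪ I·x⁻¹`
integral over `k[T ∪ I·x⁻¹]`, `I` finitely generated: every `z ∈ U` over a maximal `𝔮 ⊂ N` lying over a
maximal ideal of `T` has `closure_Z {z} ⊆ U`).  This file instantiates it at the `N` of the slot-5
assembly, the normalisation `nrm k[T ∪ I·x⁻¹]` in the tower vocabulary of `…NoZenoBirthDefs` — the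
target of the chart resolution `SurfaceTermination.ChartResolution.exists_isResolution_chartMorphism`
(stub-1 U2a, p529906), whose `σ` is proper (hence universally closed) with exactly the commuting
square assumed here.

References: The Stacks Project, Tags 01W6, 00GB [`StacksProject`].
-/

noncomputable section

-- single-problem summit: the doubled namespace component `ResolutionOfSingularities` is forced
set_option linter.dupNamespace false

namespace Summit.ResolutionOfSingularities.ResolutionOfSingularities.Theorems.NoZeno.ExcCount.ChartFibre

open CategoryTheory CategoryTheory.Limits AlgebraicGeometry TopologicalSpace Opposite
open Summit.ResolutionOfSingularities.ResolutionOfSingularities.Theorems.NoZeno.Birth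

variable {k K : Type} [Field k] [Field K] [Algebra k K]
variable (T : Subalgebra k K) {I : Ideal ↥T} {x : ↥T} {Z : Scheme.{0}} (U : Z.Opens)
  (ρ : Z ⟶ Spec (.of ↥T))

/-! ## The normalised chart ring `N = nrm k[T ∪ I·x⁻¹]` -/

/-- Every element of `nrm B = k[{y | y integral over B}]` is integral over `B` (the integral closure
is already a subalgebra). [folklore] -/
theorem isIntegral_of_mem_nrm (B : Subalgebra k K) {y : K} (hy : y ∈ nrm B) : IsIntegral ↥B y := by
  have hle : nrm B ≤ (integralClosure ↥B K).restrictScalars k := Algebra.adjoin_le fun z hz => hz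
  exact hle hy

/-- **(A2) for the normalised chart `N = nrm k[T ∪ I·x⁻¹]`** (the `N` of the slot-5 assembly): with
`ρ` separated, `I` finitely generated, `σ : U ⟶ Spec N` universally closed over `Spec T`, every
maximal `𝔮 ⊂ N` over a maximal ideal of `T` and every `z ∈ U` with `σ z = 𝔮` satisfy
`closure_Z {z} ⊆ U`. [cite: StacksProject, Tag 01W6; StacksProject, Tag 00GB] -/
theorem closure_subset_preimage_chart_nrm [IsSeparated ρ] (hI : I.FG)
    (hTN : T ≤ nrm (Algebra.adjoin k ((T : Set K) ∪
      {y : K | ∃ c : ↥T, c ∈ I ∧ y = (c : K) * (x : K)⁻¹})))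
    (σ : (U : Scheme.{0}) ⟶ Spec (.of ↥(nrm (Algebra.adjoin k ((T : Set K) ∪
      {y : K | ∃ c : ↥T, c ∈ I ∧ y = (c : K) * (x : K)⁻¹}))))) [UniversallyClosed σ]
    (hσ : U.ι ≫ ρ = σ ≫ Spec.map (CommRingCat.ofHom (Subalgebra.inclusion hTN).toRingHom))
    (𝔮 : PrimeSpectrum ↥(nrm (Algebra.adjoin k ((T : Set K) ∪
      {y : K | ∃ c : ↥T, c ∈ I ∧ y = (c : K) * (x : K)⁻¹})))) [𝔮.asIdeal.IsMaximal]
    (h𝔪 : (𝔮.asIdeal.comap (Subalgebra.inclusion hTN).toRingHom).IsMaximal)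
    (z : (U : Scheme.{0})) (hz : σ z = 𝔮) :
    closure {U.ι z} ⊆ (U : Set Z) := by
  refine closure_subset_preimage_chart (x := x) T U ρ hI (nrm (Algebra.adjoin k ((T : Set K) ∪
      {y : K | ∃ c : ↥T, c ∈ I ∧ y = (c : K) * (x : K)⁻¹}))) hTN ?_ ?_ σ hσ 𝔮 h𝔪 z hz
  · intro c hc
    exact Algebra.subset_adjoin (isIntegral_algebraMap (A := K)
      (x := (⟨(c : K) * (x : K)⁻¹, Algebra.subset_adjoin (Or.inr ⟨c, hc, rfl⟩)⟩ :
        ↥(Algebra.adjoin k ((T : Set K) ∪ {y : K | ∃ c : ↥T, c ∈ I ∧ y = (c : K) * (x : K)⁻¹})))))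
  · intro y hy
    exact isIntegral_of_mem_nrm _ hy

/-- Pointwise form for `N = nrm k[T ∪ I·x⁻¹]`: every specialisation in `Z` of a point of the fibre
`σ⁻¹(𝔮)` is a point of `U` in the same fibre. [cite: StacksProject, Tag 01W6] -/
theorem exists_eq_ι_of_mem_closure_chart_nrm [IsSeparated ρ] (hI : I.FG)
    (hTN : T ≤ nrm (Algebra.adjoin k ((T : Set K) ∪
      {y : K | ∃ c : ↥T, c ∈ I ∧ y = (c : K) * (x : K)⁻¹})))
    (σ : (U : Scheme.{0}) ⟶ Spec (.of ↥(nrm (Algebra.adjoin k ((T : Set K) ∪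
      {y : K | ∃ c : ↥T, c ∈ I ∧ y = (c : K) * (x : K)⁻¹}))))) [UniversallyClosed σ]
    (hσ : U.ι ≫ ρ = σ ≫ Spec.map (CommRingCat.ofHom (Subalgebra.inclusion hTN).toRingHom))
    (𝔮 : PrimeSpectrum ↥(nrm (Algebra.adjoin k ((T : Set K) ∪
      {y : K | ∃ c : ↥T, c ∈ I ∧ y = (c : K) * (x : K)⁻¹})))) [𝔮.asIdeal.IsMaximal]
    (h𝔪 : (𝔮.asIdeal.comap (Subalgebra.inclusion hTN).toRingHom).IsMaximal)
    (z : (U : Scheme.{0})) (hz : σ z = 𝔮) {z' : Z} (hz' : z' ∈ closure {U.ι z}) :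
    ∃ w : (U : Scheme.{0}), σ w = 𝔮 ∧ U.ι w = z' := by
  refine exists_eq_ι_of_mem_closure_chart (x := x) T U ρ hI (nrm (Algebra.adjoin k ((T : Set K) ∪
      {y : K | ∃ c : ↥T, c ∈ I ∧ y = (c : K) * (x : K)⁻¹}))) hTN ?_ ?_ σ hσ 𝔮 h𝔪 z hz hz'
  · intro c hc
    exact Algebra.subset_adjoin (isIntegral_algebraMap (A := K)
      (x := (⟨(c : K) * (x : K)⁻¹, Algebra.subset_adjoin (Or.inr ⟨c, hc, rfl⟩)⟩ :
        ↥(Algebra.adjoin k ((T : Set K) ∪ {y : K | ∃ c : ↥T, c ∈ I ∧ y = (c : K) * (x : K)⁻¹})))))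
  · intro y hy
    exact isIntegral_of_mem_nrm _ hy

/-! ## The closure computed inside the chart -/

/-- For an open `U ⊆ Z` and `A ⊆ U` whose `Z`-closure stays in `U`, the `Z`-closure of `A` is the image
of its `U`-closure (`U.ι` is an open embedding). [folklore] -/
theorem image_closure_eq_closure_image {Z : Scheme.{0}} (U : Z.Opens) (A : Set (U : Scheme.{0}))
    (h : closure (U.ι '' A) ⊆ (U : Set Z)) : U.ι '' closure A = closure (U.ι '' A) := by
  rw [U.ι.isOpenEmbedding.isEmbedding.closure_eq_preimage_closure_image,
    Set.image_preimage_eq_inter_range, Scheme.Opens.range_ι, Set.inter_eq_left.mpr h]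

/-- **The curve `closure_Z {z}` IS the image of the curve `closure_U {z}`** for the normalised chart:
with the hypotheses of `closure_subset_preimage_chart_nrm`, `U.ι '' closure {z} = closure {U.ι z}` —
so the fibre curves of `σ` over `𝔮`, closed up in `Z`, are computed inside the chart `U`.
[cite: StacksProject, Tag 01W6] -/
theorem image_closure_singleton_eq_chart_nrm [IsSeparated ρ] (hI : I.FG)
    (hTN : T ≤ nrm (Algebra.adjoin k ((T : Set K) ∪
      {y : K | ∃ c : ↥T, c ∈ I ∧ y = (c : K) * (x : K)⁻¹})))
    (σ : (U : Scheme.{0}) ⟶ Spec (.of ↥(nrm (Algebra.adjoin k ((T : Set K) ∪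
      {y : K | ∃ c : ↥T, c ∈ I ∧ y = (c : K) * (x : K)⁻¹}))))) [UniversallyClosed σ]
    (hσ : U.ι ≫ ρ = σ ≫ Spec.map (CommRingCat.ofHom (Subalgebra.inclusion hTN).toRingHom))
    (𝔮 : PrimeSpectrum ↥(nrm (Algebra.adjoin k ((T : Set K) ∪
      {y : K | ∃ c : ↥T, c ∈ I ∧ y = (c : K) * (x : K)⁻¹})))) [𝔮.asIdeal.IsMaximal]
    (h𝔪 : (𝔮.asIdeal.comap (Subalgebra.inclusion hTN).toRingHom).IsMaximal)
    (z : (U : Scheme.{0})) (hz : σ z = 𝔮) :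
    U.ι '' closure {z} = closure {U.ι z} := by
  have h := image_closure_eq_closure_image U {z}
  rw [Set.image_singleton] at h
  exact h (closure_subset_preimage_chart_nrm T U ρ hI hTN σ hσ 𝔮 h𝔪 z hz)

end Summit.ResolutionOfSingularities.ResolutionOfSingularities.Theorems.NoZeno.ExcCount.ChartFibre

end
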